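import Mathlib.Algebra.Polynomial.Derivative
import Mathlib.Algebra.Polynomial.Expand
import Mathlib.Algebra.Polynomial.Degree.Domain
import Mathlib.Algebra.CharP.Reduced
import Mathlib.FieldTheory.Finite.Basic
import HarnessLib

/-!
# [AbsTopIII] §3: Remark 3.5.1 and Remarks 3.6.1–3.6.7 (the remarks surrounding Corollary 3.6)

Mochizuki, *Topics in Absolute Anabelian Geometry III*, §3 "Nonarchimedean Log-Frobenius
Compatibility", pp. 77–86 of the author's manuscript (lit key `paper:url-5493eb38cbb7`, 164 pp.;
locators `p.N` below are pages of that manuscript — the journal pagination, J. Math. Sci. Univ.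
Tokyo 22 (2015), is not held).

These eleven remarks (Rmk 3.5.1; Rmk 3.6.1 (i)(ii); 3.6.2 (i)(ii)(iii); 3.6.3; 3.6.4; 3.6.5;
3.6.6 (i)(ii); 3.6.7) are the author's commentary on Definition 3.5 (diagrams of categories,
observables, cores, telecores) and on Corollary 3.6 (MLF-Galois-theoretic mono-anabelian
log-Frobenius compatibility).  They are almost entirely EXPOSITORY: they interpret, by analogy,
the content of Cor. 3.6 and make no new numbered mathematical assertion about the objects of §3.
Following the cell's typing rule for remarks (one node per printed sub-item; "type the
mathematical claims a Remark actually makes, record the philosophy"), this file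

* RECORDS each sub-item by a sectioning docstring quoting its thesis sentence(s) with locator, and
  says which typed declaration of the §3 statement files it glosses (Def. 3.5 =
  `DiagramsOfCategories.lean` / `DiagramMorphisms.lean` and the diagram `𝒟` of Cor. 3.6 =
  `LogFrobeniusDiagram.lean`, owned by seat abc-iut-L4-t2; Cor. 3.6 (i)–(v) itself =
  `AbsTopIII/FrobeniusPictureMLF.lean`, this seat, statement core drafted by abc-iut-L4-t2;
  this file imports none of them and re-declares nothing of theirs — it is dependency-free so
  that the remark records land independently of that import chain);
* PROVES, as kernel-checked illustrations, the three elementary algebraic facts the remarks invoke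
  verbatim as examples: Rmk 3.6.2 (ii) "the morphism `t ↦ t^p` on `𝔽_p[t]`" is a "compression"
  (typed: the Frobenius endomorphism of `𝔽_p[t]` is injective and not surjective);
  Rmk 3.6.2 (iii) "the usual Frobenius morphism in positive characteristic is compatible with the
  ring structure" / "has the effect of obliterating the differentials" (typed: Frobenius is a
  ring homomorphism; `d(f^p) = 0` in characteristic `p`); Rmk 3.6.6 (ii)
  "`dlog(U) = dU/U ↦ p·dlog(U)` induced by the Frobenius morphism `U ↦ U^p`" (typed as the
  polynomial identity `d(U^n)·U = n·U^n·dU`).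

What is deliberately NOT here: Corollary 3.6 (i)–(v) itself (`FrobeniusPictureMLF.lean`), the tempered
versions announced in Rmk 3.6.4 (no statement is printed; see the record below), and any
formal counterpart of the analogies of Rmks 3.6.3, 3.6.5, 3.6.6 (i), 3.6.7 (Hensel's lemma,
`p^n`-curvature, `MF^∇`-objects, "types of data"), which the text offers as heuristics only.
Nothing in this file takes a side on the disputed parts of inter-universal Teichmüller theory;
[AbsTopIII] is a refereed, published paper and is cited as such.
-/

noncomputable section

namespace Literature.AnabelianGeometry.AbsoluteAnabelian.AbsTopIII

open Polynomial

/-! ### Remark 3.5.1 (pp. 77–78) — recorded, no claim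

`Rmk_3_5_1 : recorded, no claim.`  Thesis sentences (p. 77): "The notion of an *observable* may
be thought of as a sort of 'partial projection of the dynamics of a diagram of categories' onto
a single category, within which it makes sense to compare objects that arise from distinct
categories at distinct vertices of the diagram."  "A *core* on a diagram of categories may be
thought of as an extraction of a certain portion of the data of the objects at the various
categories in the diagram that is *invariant* with respect to the 'dynamics' arising from the
application of the various functors in the diagram."  (p. 78) "A *telecore* may be thought of
as a sort of *partial section* — i.e., given by the telecore edges — of the 'structure
morphisms to the core' which does not disturb the coricity of the original core"; "any failure
of such a compatibility may always be eliminated — in a fashion reminiscent of a 'telescoping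
sum' — by projecting back down to the core vertex", i.e. a telecore satisfies "a sort of 'time
lag compatibility'".  Glosses Def. 3.5 (iii), (iv) (`DiagramOfCategories.Observable`,
`Observable.IsCore`, `DiagramOfCategories.Telecore` of `DiagramsOfCategories.lean`, seat L4-t2).
-/

/-! ### Remark 3.6.1 (i) (p. 82) — recorded, no new claim

`Rmk_3_6_1_i : recorded, no claim beyond Cor. 3.6 (iii), (iv).`  The remark draws the
"intuitive diagram" of the output of the log-Frobenius observable `S_log` of Cor. 3.6 (iii):
rows `… k^×_{γ+1} → (k^×_{γ+1})^pf ↩ k^×_γ → (k^×_γ)^pf …` acted on by isomorphic copies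
`Π_{γ+1} ≅ Π_γ ≅ …`, "where the arrows '→' are the natural morphisms [cf. `ι_×`!]; `k^×_γ`, for
`γ ∈ L`, is a copy of '`k̄^×`' that arises, via `id_γ`, from the vertex `γ` of `D_{≤1}`; the
arrows '↩' are the inclusions arising from the fact that `k^×_γ` is obtained by applying the
log-Frobenius functor to `k^×_{γ+1}` [cf. `ι_{log,γ}`!]; the isomorphic '`Π_γ`'s' […]
correspond to the coricity of `E` [cf. Corollary 3.6, (i)]."  Thesis sentence: "the
incompatibility assertions of Corollary 3.6, (iv), may be thought of as a statement of the
non-existence of some 'universal reference model' `k^×_model` that maps isomorphically to the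
various `k^×_γ`'s in a fashion that is compatible with the various arrows '→', '↩' of the above
diagram — cf. also Corollary 3.7, (iv), below."  Glosses Cor. 3.6 (iii)/(iv)
(`LogFrobeniusData.ObservableLogStmt` / `LogFrobeniusData.IncompatibleStmt` of
`FrobeniusPictureMLF.lean`: the observable and incompatibility statements) and Lemma 3.4 (topological distinguishability of additive and multiplicative structures, the
engine of the incompatibility proof, p. 74).
-/

/-! ### Remark 3.6.1 (ii) (p. 83) — recorded, no new claim

`Rmk_3_6_1_ii : recorded, summary of Cor. 3.6.`  "In words, the content of Corollary 3.6 may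
be summarized as follows: (a) The Galois groups that act on the various objects under
consideration are compatible with all of the operations involved — in particular, the
operations constituted by the functors `log`, `κ_An`, `φ_An` and the various related families of
homotopies — cf. the coricity asserted in Corollary 3.6, (i).  (b) By contrast, the operation
constituted by the log-Frobenius functor [as 'observed' via the observable `S_log`] is not
compatible with the field structure of the fields [i.e., '`k̄`'] involved [cf. Corollary 3.6,
(iv)].  (c) As a consequence of (a), the 'group-theoretic reconstruction' of the base field
via Corollary 1.10 is compatible with all of the operations involved, except 'momentarily' when
`log` acts on the output of `φ_An` — an operation which 'temporarily obliterates' the field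
structure of this output, although this field structure may be recovered by projecting back
down to `E` [cf. (a)] and applying `κ_An`.  This sort of 'conditional compatibility' […] is
expressed in the telecoricity asserted in Corollary 3.6, (ii)."  Closing thesis: "the projection
to `E` — i.e., the operation of looking at the Galois group — is compatible with simultaneous
execution of all the 'software' [in particular, including `log`!] under consideration" (cf.
Rmk. 1.9.8, Rmk. 3.1.2).  Glosses Cor. 3.6 (i), (ii), (iv).
-/

/-! ### Remark 3.6.2 (i) (p. 83) — recorded, no claim

`Rmk_3_6_2_i : recorded, no claim.`  "The reasoning that lies behind the name 'log-Frobenius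
functor' may be understood as follows.  At a very naive level, the natural logarithm may be
thought of as a sort of 'raising to the `ε`-th power' [where `ε → 0` is some indefinite positive
infinitesimal] — i.e., '`ε`' plays the role in characteristic [`ε →`]`0` of '`p`' in
characteristic `p > 0`.  More generally, the logarithm frequently appears in the context of
Frobenius actions, in particular in discussions involving canonical coordinates, such as in
[Mzk1], Chapter III, §1."  (Heuristic: `(x^ε - 1)/ε → log x`; nothing is asserted.)
-/

/-! ### Remark 3.6.2 (ii) (p. 83) — "Frobenius morphisms as compression morphisms"

"In general, Frobenius morphisms may be thought of as 'compression morphisms'.  For instance,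
this phenomenon may be seen in the most basic example of a Frobenius morphism in characteristic
`p > 0`, i.e., the morphism `t ↦ t^p` on `𝔽_p[t]`.  Put another way, the 'compression'
operation inherent in a Frobenius morphism may be thought of as an approximation of some sort
of 'absolute constant object' [such as `𝔽_p`].  In the context of the log-Frobenius functor,
this sort of compression phenomenon may be seen in the pre-log-shells defined in Definition
3.1, (iv)" (pre-log-shell: `GaloisPadicLog.preLogShell`, seat L4-t2; `preLogShell` /
`logShell` of `LogShells.lean`, seat L4-t3).  The one mathematical example the remark names is
typed below: on `𝔽_p[t]` the Frobenius endomorphism (which, `𝔽_p` being fixed by Frobenius, IS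
the `𝔽_p`-algebra map `t ↦ t^p`) is injective with proper image — a "compression" of `𝔽_p[t]`
onto the subring `𝔽_p[t^p]`.
-/

section Frobenius

variable (p : ℕ) [hp : Fact p.Prime]

/-- Rmk. 3.6.2 (ii): "the most basic example of a Frobenius morphism in characteristic `p > 0`,
i.e., the morphism `t ↦ t^p` on `𝔽_p[t]`" — the Frobenius endomorphism `f ↦ f^p` of `𝔽_p[t]`
is the map `f(t) ↦ f(t^p)` (`Polynomial.expand`), because Frobenius is the identity on `𝔽_p`.
[cite: MochizukiAbsTopIII2015, Rmk 3.6.2 (ii) p.83] -/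
theorem Rmk_3_6_2_ii_frobenius_eq_expand (f : (ZMod p)[X]) :
    frobenius (ZMod p)[X] p f = expand (ZMod p) p f := by
  rw [frobenius_def, ← map_frobenius_expand, ZMod.frobenius_zmod, Polynomial.map_id]

/-- Rmk. 3.6.2 (ii), "compression", first half: the Frobenius endomorphism `t ↦ t^p` of
`𝔽_p[t]` is injective (it loses no information …). [cite: MochizukiAbsTopIII2015, Rmk 3.6.2 (ii) p.83] -/
theorem Rmk_3_6_2_ii_frobenius_injective :
    Function.Injective (frobenius (ZMod p)[X] p) :=
  frobenius_inj (ZMod p)[X] p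

/-- Rmk. 3.6.2 (ii), "compression", second half: the Frobenius endomorphism `t ↦ t^p` of
`𝔽_p[t]` is NOT surjective (… but compresses `𝔽_p[t]` onto the proper subring `𝔽_p[t^p]`:
`t` itself is not a `p`-th power, by degree). [cite: MochizukiAbsTopIII2015, Rmk 3.6.2 (ii) p.83] -/
theorem Rmk_3_6_2_ii_frobenius_not_surjective :
    ¬ Function.Surjective (frobenius (ZMod p)[X] p) := by
  intro h
  obtain ⟨f, hf⟩ := h X
  rw [frobenius_def] at hf
  have hdeg := congrArg natDegree hf
  rw [natDegree_pow, natDegree_X] at hdeg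
  have h1 : p ∣ 1 := ⟨f.natDegree, hdeg.symm⟩
  exact hp.out.ne_one (Nat.dvd_one.mp h1)

end Frobenius

/-! ### Remark 3.6.2 (iii) (p. 84) — Frobenius vs. log-Frobenius

"Whereas the log-Frobenius functor obliterates the field [or ring] structure [cf. Remark 3.6.1,
(ii), (b)] of the fields involved, the usual Frobenius morphism in positive characteristic is
compatible with the ring structure of the rings involved.  On the other hand, unlike generically
smooth morphisms, the Frobenius morphism in positive characteristic has the effect of
'obliterating the differentials' of the schemes involved."  The first clause about `log` is
Cor. 3.6 (iv) (`LogFrobeniusData.IncompatibleStmt`).  The two claims about Frobenius in characteristic `p` are typed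
below for a commutative ring `R` of characteristic `p` (ring compatibility) and for the affine
line over it (`d(f^p) = p·f^{p-1}·df = 0`, i.e. Frobenius kills Kähler differentials of `R[t]`).
-/

section FrobeniusDifferentials

variable {R : Type*} [CommRing R] (p : ℕ) [Fact p.Prime] [CharP R p]

/-- Rmk. 3.6.2 (iii), first claim: "the usual Frobenius morphism in positive characteristic is
compatible with the ring structure of the rings involved" — `x ↦ x^p` is additive and
multiplicative (Mathlib packages it as the ring endomorphism `frobenius R p`).
[cite: MochizukiAbsTopIII2015, Rmk 3.6.2 (iii) p.84] -/
theorem Rmk_3_6_2_iii_frobenius_compatible_ring (x y : R) :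
    (x + y) ^ p = x ^ p + y ^ p ∧ (x * y) ^ p = x ^ p * y ^ p :=
  ⟨add_pow_char x y p, mul_pow x y p⟩

/-- Rmk. 3.6.2 (iii), second claim: "the Frobenius morphism in positive characteristic has the
effect of 'obliterating the differentials'": for every `f ∈ R[t]`, `char R = p`, the derivative
of `f^p` (the pull-back of `df` along Frobenius) vanishes: `d(f^p) = p·f^{p-1}·df = 0`.
[cite: MochizukiAbsTopIII2015, Rmk 3.6.2 (iii) p.84] -/
theorem Rmk_3_6_2_iii_derivative_frobenius_eq_zero (f : R[X]) :
    derivative (frobenius R[X] p f) = 0 := by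
  rw [frobenius_def, derivative_pow, CharP.cast_eq_zero, C_0, zero_mul, zero_mul]

end FrobeniusDifferentials

/-! ### Remark 3.6.3 (p. 84) — recorded, no claim

`Rmk_3_6_3 : recorded, no claim.`  "The diagram `D` of Corollary 3.6 — cf., especially, the
first two rows `D_{≤2}` and the various natural actions of `ℤ` discussed in Corollary 3.6, (v)
— may be thought of as a sort of combinatorial version of `𝔾_m` — cf. the point of view of
Remark 1.9.7."  Glosses Cor. 3.6 (v) (the `ℤ`-action by nexus-classes of self-equivalences,
`LogFrobeniusData.ShiftStmt` of `FrobeniusPictureMLF.lean`).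
-/

/-! ### Remark 3.6.4 (p. 84) — claim recorded, not typed

`Rmk_3_6_4 : recorded; a claim WITHOUT a printed statement.`  Verbatim: "One verifies
immediately that one may give a tempered version of Propositions 3.2, 3.3; Corollary 3.6 [cf.
Remarks 1.9.1, 1.10.2]."  No tempered statement is printed (Rmk. 3.1.3 p. 71 likewise "leave[s]
to the reader the routine details of developing the resulting tempered version").  Typing
note for consumers: the cell's Cor. 3.6 statement structure (`LogFrobeniusCompatible` of
`FrobeniusPictureMLF.lean`, over the abstract input `LogFrobeniusData` of seat L4-t2's
`LogFrobeniusDiagram.lean`) is stated over ABSTRACT categories and functors and does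
not know whether the group `Π` of an MLF-Galois pair is a profinite or a tempered fundamental
group; a "tempered version" is therefore an INSTANCE of the same structure on tempered model
data (the tempered-`π₁` interface of layer L3, seat abc-iut-L3-t2), not a new statement.  No
`Prop` is declared here, so nothing unstated is asserted.
-/

/-! ### Remark 3.6.5 (p. 84) — recorded, analogy only

`Rmk_3_6_5 : recorded, no claim.`  "The notions of 'core' and 'telecore' are reminiscent of
certain aspects of 'Hensel's lemma' [cf., e.g., [Mzk21], Lemma 2.1]": the analogy
"cores ⟷ sets of solutions of 'étale', i.e., 'slope zero' equations; telecores ⟷ sets of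
solutions of 'positive slope' equations" — in the étale case "the set of solutions lifts
uniquely, i.e., 'transports isomorphically' through the operation", in the positive slope case
"the Jacobian matrix involved is invertible up to a factor of `p`" so the solutions
"essentially transport isomorphically, up to a brief temporary lag" (cf. Rmk. 3.6.1 (ii) (c));
and, in terms of connections on bases on which `p` is nilpotent, "cores ⟷ vanishing
`p^n`-curvature; telecores ⟷ nilpotent `p^n`-curvature" ([Mzk4] Ch. II §2, [Mzk7] §2.4).
(The étale case of Hensel's lemma for `ℤ_p` is Mathlib's `hensels_lemma`; no formal
counterpart of the analogy is asserted.)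
-/

/-! ### Remark 3.6.6 (i) (p. 85) — recorded, no claim

`Rmk_3_6_6_i : recorded, no claim.`  Question posed: "What are the values of the positive
slopes implicitly involved in a telecore?"  Author's answer "at the time of writing": "one
should regard telecores as containing 'all positive slopes', or, alternatively, 'positive
slopes of an indeterminate nature', which one may think of as corresponding to the lengths of
the various paths emanating from the core vertex that one may travel along before descending
back down to the core [cf. Remark 3.5.1]"; by the analogy with uniformizing `MF^∇`-objects of
[Mzk1], [Mzk4] (Rmk. 3.7.2), "since telecores are of an 'abstract, combinatorial nature' [cf.
Remark 1.9.7] — i.e., not of a 'linear, module-theoretic nature' […] it seems somewhat natural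
that this 'combinatorial non-linearity' should interfere with any attempts to 'separate out the
various distinct positive slopes', via, for instance, a 'linear filtration'".
-/

/-! ### Remark 3.6.6 (ii) (p. 85) — the slope dictionary; `dlog(U^p) = p · dlog(U)`

Recorded: "From the point of view of the analogy with [uniformizing] `MF^∇`-objects, one has the
following [rough] correspondence: slope zero ⟷ Frobenius '↷' (an isomorphism); positive slope
⟷ Frobenius '↷' `p^n ·` (an isomorphism)."  "Perhaps the most fundamental example in the
`p`-adic theory of such a [uniformizing] `MF^∇`-object arises from the `p`-adic Galois
representation obtained by extracting `p`-power roots of the standard unit `U` on the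
multiplicative group `𝔾_m` over `ℤ_p`, in which case the 'positive slope' involved corresponds
to the action `dlog(U) = dU/U ↦ p · dlog(U)` induced by the Frobenius morphism `U ↦ U^p`."  The
closing analogy — multiplication by a positive power of `p` "corresponds precisely to [the]
'temporary failure of coricity'" of the mono-anabelian telecore of Cor. 3.6 (ii), remedied by
projecting back down to `Anab` — glosses Cor. 3.6 (ii)/(iv) (`FrobeniusPictureMLF.lean`) and is
recorded only.
The displayed identity is typed below in the coordinate ring `R[U]` of the affine line (hence of
`𝔾_m` after inverting `U`): `d(U^n) · U = n · U^n · dU` with `dU = 1`, i.e. the pull-back of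
`dlog U` along `U ↦ U^n` is `n · dlog U`; the remark's case is `n = p`.
-/

section Dlog

variable {R : Type*} [CommRing R]

/-- Rmk. 3.6.6 (ii): "`dlog(U) = dU/U ↦ p · dlog(U)` induced by the Frobenius morphism
`U ↦ U^p`", typed denominator-free in `R[U]` for any exponent `n ≥ 1`:
`d(U^n) · U = n · U^n` (so `d(U^n)/U^n = n · dU/U`). [cite: MochizukiAbsTopIII2015, Rmk 3.6.6 (ii) p.85] -/
theorem Rmk_3_6_6_ii_dlog_pow (n : ℕ) (hn : 0 < n) :
    derivative ((X : R[X]) ^ n) * X = C (n : R) * X ^ n := by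
  rw [derivative_X_pow, mul_assoc, ← pow_succ, Nat.sub_add_cancel hn]

/-- Rmk. 3.6.6 (ii), the printed case `n = p`: along Frobenius `U ↦ U^p` one has
`d(U^p) · U = p · U^p`, i.e. `dlog(U^p) = p · dlog(U)`. [cite: MochizukiAbsTopIII2015, Rmk 3.6.6 (ii) p.85] -/
theorem Rmk_3_6_6_ii_dlog_frobenius (p : ℕ) [Fact p.Prime] :
    derivative ((X : R[X]) ^ p) * X = C (p : R) * X ^ p :=
  Rmk_3_6_6_ii_dlog_pow p (Nat.Prime.pos Fact.out)

end Dlog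

/-! ### Remark 3.6.7 (pp. 85–86) — recorded, no claim

`Rmk_3_6_7 : recorded, no claim.`  "Although we have formulated things in the language of
categories and functors, in fact, the mathematical constructs in which we are ultimately
interested have much more elaborate structures than categories and functors.  That is to say:
In fact, what we are really interested in is not so much 'categories' and 'functors', but
rather 'types of data' and 'operations' [i.e., algorithms!] that convert some 'input type of
data' into some 'output type of data'."  Supporting observation (p. 86): "the crucial functors
`log`, `κ_An` of Corollary 3.6 are equivalences of categories [which, moreover, are, in certain
cases, isomorphic to the identity functor! — cf. Definition 3.1, (iv), (vi)] — i.e., from the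
point of view of the purely category-theoretic structure […] these functors are 'not doing
anything'" (typed facts: `log_{TF,TF} ≅ id`, Def. 3.1 (iv) p. 68; `κ_An` an equivalence,
Def. 3.1 (vi) p. 70 — seat L4-t2's Def. 3.1 files); "To some extent, this state of affairs may
be remedied by working with appropriate observables […] as in Corollary 3.6, (iii), (iv).
Nevertheless, the use of observables does not constitute a fundamental solution"; the author
announces "appropriate 'enhancements' to the usual theory of categories and functors" for a
future paper.
-/

end Literature.AnabelianGeometry.AbsoluteAnabelian.AbsTopIII

end
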